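import Mathlib
import HarnessLib
import Summits.HubbardSuperconductivity.HubbardSuperconductivity.Theorems.KLProgrammeKLRegimeEnginePairTransferMemberTowerProfiles

/-!
# Route `KLProgramme` — ENGINE (stmt-HubbardSuperconductivity-20437 `KLRegimeEngineV17F2`), row (c) binder #8: the PLAIN member's resolvent-tower package
# `htower` FROM hsucc-SHAPED ROWS, the 6–2 / born class KEPT AS ONE LOCALISED ROW — **`klmt_htower_family_sigma`**
# (cell gate-hubbard-kl, seat hubbard-kl-k3c1-p1 g25, technique «composed-map remainder propagation»; item «ROW-(c)-LADSZ-MASSES» stage 4 = the binder-#8 answer to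
# LOCATED #22 «(c)-OUT-NEAR-SLICE-LEGS» §4 (k3c2-p2 g30; pen g29 (R597)): `klmd_defect_le_rows_family` (…MemberDefectRowsFamily, g13) with the particle–hole classes in
# masses/«PH-PROFILE» form and the Σ-triple as a ROW; sequel of `klmt_htower_family_profiles`)

WHY.  `klmt_htower_family_masses/…_profiles/…_grid` split the born class `(ẇG)(ΦG)·V6·Σ` into GLOBAL sups `‖V6 (n+1) t X‖ ≤ M6` (all labels) and `‖Sg (n+1) t p σ‖ ≤ M2` (all `p`)
times the flat born mass — located #22 §4: with a pinned leg on or near the slice the 6-point tree gives `M6 ≳ 2U²/Λ_t`, so `2·1024·15367·M6·M2 ≳ 3·10⁶·U⁴/Λₙ′` exceeds every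
decaying slot from `n′ ≈ 62 + log₂ Klam` on (pen (R597): v17 not pinned).  The registered CLASS-ROWS door `klmd_defect_le_rows_family` never takes those sups: its `hS` is the
NORM OF THE Σ-TRIPLE ITSELF, kernels inside the loop sum, labels pinned to the loop momentum — the object whose true size is DOS-slope / thermal small (#22 §3, cure (C′)).
So **`klmt_htower_family_sigma`**: the fourteen-conjunct `htower` (generic `Tb`/`Bar`; = `klmt_htower_plain`'s conclusion) from h5g″'s FAMILY PINS and, per in-class `Qm`,
the rows AT `j = n+1`: a priori along the slice · history a priori · (F)(i) model row + cap · smallness · `0 ≤ M4`, `‖V (n+1) t X‖ ≤ M4` (the 4-point kernel, `≍ U` at every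
label) · `RH₁` · **the Σ-triple row `RS`** (function-valued, `t`-uniform) · `RL₁` · consumer rows with `J = (Λd)(½RH + (βL²)⁻³(M4²·ENV_d + M4²·ENV_x + 2·RS)) + RL`, the
particle–hole envelopes as in `…_profiles` (k3c2-p2 «PH-PROFILE», flat at `n = 0`).  NO `M6`, NO `M2`, NO born mass: the 6–2 class reaches the budget row only through `RS(x,y)`.
Inside: `ρ := klRungProfile` by name; `klmd_defect_le_rows_family` at `j = n+1` with `hP/hQ := klmd_sum3/2_ite_mul_le` (kernel sup × weight mass) and `hS := RS`'s row;
`Wd/Wx_member_row_le_profile` / `_flat_le`; `softSymbolCompl_self` bridge into `klmt_htower_plain`.  Plumbing + real analysis over landed doors; every row is a HYPOTHESIS of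
its owner (class #1 / (c) closer / k3c2-p2 / E1 (Σ)); nothing here asserts (c), any open row of 20437, K3, U₀, the window or superconductivity.  0 kit · 0 lit.
-/

noncomputable section

namespace Summit.HubbardSuperconductivity.HubbardSuperconductivity.Theorems.KLRegimeSplit

set_option linter.dupNamespace false -- summit = problem name (single-conjunct summit), D-0017

open Finset Matrix Set Literature.MathematicalPhysics.QuantumLattice Literature.Probability.LatticeModels GrassmannAlgebra
open Summit.HubbardSuperconductivity.HubbardSuperconductivity.Theorems.KLProgrammeLegKernels
open Summit.HubbardSuperconductivity.HubbardSuperconductivity.Theorems.TwoPointAssembly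
open Summit.HubbardSuperconductivity.HubbardSuperconductivity.Theorems.DispersionFlow
open Summit.HubbardSuperconductivity.HubbardSuperconductivity.Theorems.KLRegimeWick
open Summit.HubbardSuperconductivity.HubbardSuperconductivity.Theorems.EngineV8

/-! ## §0 Scalar bookkeeping -/

/-- Monotonicity of the rows-form majorant in the two particle–hole weight masses (the Σ-triple row untouched). -/
theorem klmt_sigma_mono {Λd c3 RH RL RS M44 Sd Sx Wd Wx : ℝ} (hΛ : 0 ≤ Λd) (hc : 0 ≤ c3) (h4 : 0 ≤ M44) (hd : Sd ≤ Wd) (hx : Sx ≤ Wx) :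
    Λd * (2⁻¹ * RH + c3 * (M44 * Sd + M44 * Sx + 2 * RS)) + RL ≤ Λd * (2⁻¹ * RH + c3 * (M44 * Wd + M44 * Wx + 2 * RS)) + RL := by
  have h1 : M44 * Sd + M44 * Sx + 2 * RS ≤ M44 * Wd + M44 * Wx + 2 * RS := by nlinarith
  nlinarith [mul_le_mul_of_nonneg_left (mul_le_mul_of_nonneg_left h1 hc) hΛ]

variable (L M : ℕ) [NeZero L] [NeZero M]

set_option maxHeartbeats 3200000 in -- long pinning equations (h5g″'s hsucc pins) + fourteen-conjunct package; plumbing only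
/-- **`klmt_htower_family_sigma`** — the `htower` package (keying `(n, n+1)`, generic bar `Tb` / slot `Bar`) of the PLAIN member from hsucc-shaped rows with the 6–2 / born
class as ONE localised Σ-triple row (module docstring). -/
theorem klmt_htower_family_sigma {β U μ : ℝ} {n N : ℕ} {m : ℝ} (hm : 0 ≤ m) (hm7 : 3 / 2 * m * 738288 ≤ 1 / 3) {Rn : RenConsts} {G : GeoConsts}
    (hK : FrameOK Rn U N μ (klFlowFrameU L M β U μ (n + 1))) (hβ : klBetaMin ≤ β) (hβL : β ≤ L) (hG : (2 : ℝ) ^ 19 ≤ G.bhi)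
    (hZ : ∀ Λ ∈ Icc (klScale klE0 (n + 1)) (klScale klE0 n), hubbardEffPartitionFnCT L M β U μ 0 (klFlowFrameU L M β U μ (n + 1)) Λ ≠ 0)
    -- the two-shell REGIME kit of the «PH-PROFILE» envelope (row 68 of KLTC-INDEX v12)
    {A2s : ℝ} {u2s : RenConsts → ℝ} (h2s : TwoShellFrameAreaAt A2s u2s) (hA2s : 0 ≤ A2s) (hR : Rn.WF2) (hU : 0 < U) (hUu2 : U ≤ u2s Rn) (hμ : μ ∈ klWindowC)
    (hj'β : Real.pi / (4 * β) ≤ klScale klE0 (n + 1)) (hGδ : (4 + 8 / 3 * Rn.Gfr 1 * U ^ 2) * (2 * Real.pi / L) ≤ klScale klE0 (n + 1))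
    (hE0c : 1 ≤ n → 2 * klScale klE0 n + (4 + 8 / 3 * Rn.Gfr 1 * U ^ 2) * (2 * Real.pi / L) ≤ klE0)
    (A A' : ℕ → TorusSite 2 L → ℝ → Matrix (TorusSite 2 L) (TorusSite 2 L) ℂ) (b b' : ℕ → TorusSite 2 L → ℝ → TorusSite 2 L → ℂ)
    (ρ : ℕ → TorusSite 2 L → TorusSite 2 L → ℝ) (V : ℕ → ℝ → (Fin 4 → HubbardFieldIdx L M) → ℂ) (V6 : ℕ → ℝ → (Fin 6 → HubbardFieldIdx L M) → ℂ)
    (Sg : ℕ → ℝ → FreqMomentum L M → Fin 2 → ℂ) (Hd : ℕ → ℝ → (Fin 4 → HubbardFieldIdx L M) → ℂ) (Φ : ℕ → ℝ → FreqMomentum L M → ℝ) (Wd : ℝ → FreqMomentum L M → ℝ)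
    (Br : ℕ → TorusSite 2 L → ℝ → TorusSite 2 L × MatsubaraIdx M → ℂ)
    (hAdef : A = fun j Qm t => Matrix.of fun k k' : TorusSite 2 L => if k ∈ klBall L μ 0 ∧ k' ∈ klBall L μ 0 then vertexFn L M β (gaussConv ℂ (softCovOf L M β μ (klFlowFrameU L M β U μ (n + 1)) (softSymbolCompl L M β μ (klFlowFrameU L M β U μ (n + 1)) (n + 1) j) + hubbardCovAboveCT L M β μ 0 (klFlowFrameU L M β U μ (n + 1)) (klScale klE0 (n + 1)) - hubbardCovAboveCT L M β μ 0 (klFlowFrameU L M β U μ (n + 1)) (klScale klE0 n + t * (klScale klE0 (n + 1) - klScale klE0 n))) (hubbardEffectiveActionCT L M β U μ 0 (klFlowFrameU L M β U μ (n + 1)) (klScale klE0 n + t * (klScale klE0 (n + 1) - klScale klE0 n)))) 4 ![(((omega0 M, k'), 0), 0), ((((omega0 M).rev, Qm - k'), 1), 0), ((((omega0 M).rev, Qm - k), 1), 1), (((omega0 M, k), 0), 1)] else 0)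
    (hA'def : A' = fun j Qm t => Matrix.of fun k k' : TorusSite 2 L => if k ∈ klBall L μ 0 ∧ k' ∈ klBall L μ 0 then (klScale klE0 (n + 1) - klScale klE0 n) • -((2 : ℂ)⁻¹ * vertexFn L M β (gaussConv ℂ (softCovOf L M β μ (klFlowFrameU L M β U μ (n + 1)) (softSymbolCompl L M β μ (klFlowFrameU L M β U μ (n + 1)) (n + 1) j) + hubbardCovAboveCT L M β μ 0 (klFlowFrameU L M β U μ (n + 1)) (klScale klE0 (n + 1)) - hubbardCovAboveCT L M β μ 0 (klFlowFrameU L M β U μ (n + 1)) (klScale klE0 n + t * (klScale klE0 (n + 1) - klScale klE0 n))) (grassmannDerivPairing ℂ (Matrix.of fun X Y : HubbardFieldIdx L M => deriv (fun Λ'' : ℝ => hubbardCovAboveCT L M β μ 0 (klFlowFrameU L M β U μ (n + 1)) Λ'' X Y) (klScale klE0 n + t * (klScale klE0 (n + 1) - klScale klE0 n))) (hubbardEffectiveActionCT L M β U μ 0 (klFlowFrameU L M β U μ (n + 1)) (klScale klE0 n + t * (klScale klE0 (n + 1) - klScale klE0 n))) (hubbardEffectiveActionCT L M β U μ 0 (klFlowFrameU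 L M β U μ (n + 1)) (klScale klE0 n + t * (klScale klE0 (n + 1) - klScale klE0 n))))) 4 ![(((omega0 M, k'), 0), 0), ((((omega0 M).rev, Qm - k'), 1), 0), ((((omega0 M).rev, Qm - k), 1), 1), (((omega0 M, k), 0), 1)]) else 0)
    (hbdef : b = fun j Qm t p => -((klBubbleMass L M β μ (klFlowFrameU L M β U μ (n + 1)) (fun k => (softSymbolCompl L M β μ (klFlowFrameU L M β U μ (n + 1)) (n + 1) j) k + (hubbardCutoffWeightCT L M β μ (klFlowFrameU L M β U μ (n + 1)) (klScale klE0 (n + 1)) k - hubbardCutoffWeightCT L M β μ (klFlowFrameU L M β U μ (n + 1)) (klScale klE0 n + t * (klScale klE0 (n + 1) - klScale klE0 n)) k)) (fun k => (softSymbolCompl L M β μ (klFlowFrameU L M β U μ (n + 1)) (n + 1) j) k + (hubbardCutoffWeightCT L M β μ (klFlowFrameU L M β U μ (n + 1)) (klScale klE0 (n + 1)) k - hubbardCutoffWeightCT L M β μ (klFlowFrameU L M β U μ (n + 1)) (klScale klE0 n + t * (klScale klE0 (n + 1) - klScale klE0 n)) k)) Qm p : ℝ) : ℂ))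
    (hb'def : b' = fun j Qm t p => (((klScale klE0 (n + 1) - klScale klE0 n) * (klBubbleMass L M β μ (klFlowFrameU L M β U μ (n + 1)) (fun k => deriv (fun Λ' => hubbardCutoffWeightCT L M β μ (klFlowFrameU L M β U μ (n + 1)) Λ' k) (klScale klE0 n + t * (klScale klE0 (n + 1) - klScale klE0 n))) (fun k => (softSymbolCompl L M β μ (klFlowFrameU L M β U μ (n + 1)) (n + 1) j) k + (hubbardCutoffWeightCT L M β μ (klFlowFrameU L M β U μ (n + 1)) (klScale klE0 (n + 1)) k - hubbardCutoffWeightCT L M β μ (klFlowFrameU L M β U μ (n + 1)) (klScale klE0 n + t * (klScale klE0 (n + 1) - klScale klE0 n)) k)) Qm p + klBubbleMass L M β μ (klFlowFrameU L M β U μ (n + 1)) (fun k => (softSymbolCompl L M β μ (klFlowFrameU L M β U μ (n + 1)) (n + 1) j) k + (hubbardCutoffWeightCT L M β μ (klFlowFrameU L M β U μ (n + 1)) (klScale klE0 (n + 1)) k - hubbardCutoffWeightCT L M β μ (klFlowFrameU L M β U μ (n + 1)) (klScale klE0 n + t * (klScale klE0 (n + 1) - klScale klE0 n)) k)) (fun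 k => deriv (fun Λ' => hubbardCutoffWeightCT L M β μ (klFlowFrameU L M β U μ (n + 1)) Λ' k) (klScale klE0 n + t * (klScale klE0 (n + 1) - klScale klE0 n))) Qm p) : ℝ) : ℂ))
    (hρdef : ρ = fun j Qm c => klRungProfile L M β μ (klFlowFrameU L M β U μ (n + 1)) n (softSymbolCompl L M β μ (klFlowFrameU L M β U μ (n + 1)) (n + 1) j) Qm c)
    (hV : V = fun j t X => vertexFn L M β (gaussConv ℂ (softCovOf L M β μ (klFlowFrameU L M β U μ (n + 1)) (softSymbolCompl L M β μ (klFlowFrameU L M β U μ (n + 1)) (n + 1) j) + hubbardCovAboveCT L M β μ 0 (klFlowFrameU L M β U μ (n + 1)) (klScale klE0 (n + 1)) - hubbardCovAboveCT L M β μ 0 (klFlowFrameU L M β U μ (n + 1)) (klScale klE0 n + t * (klScale klE0 (n + 1) - klScale klE0 n))) (hubbardEffectiveActionCT L M β U μ 0 (klFlowFrameU L M β U μ (n + 1)) (klScale klE0 n + t * (klScale klE0 (n + 1) - klScale klE0 n)))) 4 X)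
    (hV6 : V6 = fun j t X => vertexFn L M β (gaussConv ℂ (softCovOf L M β μ (klFlowFrameU L M β U μ (n + 1)) (softSymbolCompl L M β μ (klFlowFrameU L M β U μ (n + 1)) (n + 1) j) + hubbardCovAboveCT L M β μ 0 (klFlowFrameU L M β U μ (n + 1)) (klScale klE0 (n + 1)) - hubbardCovAboveCT L M β μ 0 (klFlowFrameU L M β U μ (n + 1)) (klScale klE0 n + t * (klScale klE0 (n + 1) - klScale klE0 n))) (hubbardEffectiveActionCT L M β U μ 0 (klFlowFrameU L M β U μ (n + 1)) (klScale klE0 n + t * (klScale klE0 (n + 1) - klScale klE0 n)))) 6 X)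
    (hSg : Sg = fun j t p σ => selfEnergy L M β (gaussConv ℂ (softCovOf L M β μ (klFlowFrameU L M β U μ (n + 1)) (softSymbolCompl L M β μ (klFlowFrameU L M β U μ (n + 1)) (n + 1) j) + hubbardCovAboveCT L M β μ 0 (klFlowFrameU L M β U μ (n + 1)) (klScale klE0 (n + 1)) - hubbardCovAboveCT L M β μ 0 (klFlowFrameU L M β U μ (n + 1)) (klScale klE0 n + t * (klScale klE0 (n + 1) - klScale klE0 n))) (hubbardEffectiveActionCT L M β U μ 0 (klFlowFrameU L M β U μ (n + 1)) (klScale klE0 n + t * (klScale klE0 (n + 1) - klScale klE0 n)))) p σ)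
    (hHd : Hd = fun j t X => vertexFn L M β (dblFold ℂ (grassmannLaplacian ℂ (crossCov ℂ (Matrix.of fun X Y : HubbardFieldIdx L M => deriv (fun Λ' : ℝ => hubbardCovAboveCT L M β μ 0 (klFlowFrameU L M β U μ (n + 1)) Λ' X Y) (klScale klE0 n + t * (klScale klE0 (n + 1) - klScale klE0 n)))) ((gaussConv ℂ (crossCov ℂ (softCovOf L M β μ (klFlowFrameU L M β U μ (n + 1)) (softSymbolCompl L M β μ (klFlowFrameU L M β U μ (n + 1)) (n + 1) j) + hubbardCovAboveCT L M β μ 0 (klFlowFrameU L M β U μ (n + 1)) (klScale klE0 (n + 1)) - hubbardCovAboveCT L M β μ 0 (klFlowFrameU L M β U μ (n + 1)) (klScale klE0 n + t * (klScale klE0 (n + 1) - klScale klE0 n)))) - grassmannLaplacian ℂ (crossCov ℂ (softCovOf L M β μ (klFlowFrameU L M β U μ (n + 1)) (softSymbolCompl L M β μ (klFlowFrameU L M β U μ (n + 1)) (n + 1) j) + hubbardCovAboveCT L M β μ 0 (klFlowFrameU L M β U μ (n + 1)) (klScale klE0 (n + 1)) - hubbardCovAboveCT L M β μ 0 (klFlowFrameU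 L M β U μ (n + 1)) (klScale klE0 n + t * (klScale klE0 (n + 1) - klScale klE0 n))))) (dblCopy ℂ 0 (gaussConv ℂ (softCovOf L M β μ (klFlowFrameU L M β U μ (n + 1)) (softSymbolCompl L M β μ (klFlowFrameU L M β U μ (n + 1)) (n + 1) j) + hubbardCovAboveCT L M β μ 0 (klFlowFrameU L M β U μ (n + 1)) (klScale klE0 (n + 1)) - hubbardCovAboveCT L M β μ 0 (klFlowFrameU L M β U μ (n + 1)) (klScale klE0 n + t * (klScale klE0 (n + 1) - klScale klE0 n))) (hubbardEffectiveActionCT L M β U μ 0 (klFlowFrameU L M β U μ (n + 1)) (klScale klE0 n + t * (klScale klE0 (n + 1) - klScale klE0 n)))) * dblCopy ℂ 1 (gaussConv ℂ (softCovOf L M β μ (klFlowFrameU L M β U μ (n + 1)) (softSymbolCompl L M β μ (klFlowFrameU L M β U μ (n + 1)) (n + 1) j) + hubbardCovAboveCT L M β μ 0 (klFlowFrameU L M β U μ (n + 1)) (klScale klE0 (n + 1)) - hubbardCovAboveCT L M β μ 0 (klFlowFrameU L M β U μ (n + 1)) (klScale klE0 n + t * (klScale klE0 (n + 1) - klScale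 klE0 n))) (hubbardEffectiveActionCT L M β U μ 0 (klFlowFrameU L M β U μ (n + 1)) (klScale klE0 n + t * (klScale klE0 (n + 1) - klScale klE0 n)))))))) 4 X)
    (hΦ : Φ = fun j t k => (softSymbolCompl L M β μ (klFlowFrameU L M β U μ (n + 1)) (n + 1) j) k + (hubbardCutoffWeightCT L M β μ (klFlowFrameU L M β U μ (n + 1)) (klScale klE0 (n + 1)) k - hubbardCutoffWeightCT L M β μ (klFlowFrameU L M β U μ (n + 1)) (klScale klE0 n + t * (klScale klE0 (n + 1) - klScale klE0 n)) k))
    (hWd : Wd = fun t k => deriv (fun Λ' : ℝ => hubbardCutoffWeightCT L M β μ (klFlowFrameU L M β U μ (n + 1)) Λ' k) (klScale klE0 n + t * (klScale klE0 (n + 1) - klScale klE0 n)))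
    (hBr : Br = fun j Qm t z => -(((((β * (L : ℝ) ^ 2 : ℝ) : ℂ)))⁻¹ * propCT L M β μ (klFlowFrameU L M β U μ (n + 1)) (z.2, z.1) * propCT L M β μ (klFlowFrameU L M β U μ (n + 1)) (z.2.rev, Qm - z.1)) * ((((klScale klE0 (n + 1) - klScale klE0 n) * (-Wd t (z.2, z.1) * Φ j t (z.2.rev, Qm - z.1) - Φ j t (z.2, z.1) * Wd t (z.2.rev, Qm - z.1))) : ℝ) : ℂ))
    (Tb Bar : TorusSite 2 L → TorusSite 2 L → TorusSite 2 L → ℝ)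
    (hrows : ∀ Qm : TorusSite 2 L, IsPairClassAt L Qm (n + 1) →
      ∃ (r' e₁ M4 : ℝ) (η E₁ RH RS RL : TorusSite 2 L → TorusSite 2 L → ℝ), 0 ≤ r' ∧ 0 ≤ e₁ ∧
        -- a priori along the slice; history a priori [class #1]
        (∀ t ∈ Icc (0 : ℝ) 1, ∀ x y, ‖A (n + 1) Qm t x y‖ ≤ m) ∧
        (∀ x y, ‖klMemberArrayF L M β U μ n (softSymbolCompl L M β μ (klFlowFrameU L M β U μ n) n (n + 1)) Qm x y‖ ≤ m) ∧
        -- (F)(i): majorant of the FRAME SHIFT `K_n → K_(n+1)` of the history member (model objects) + its scalar cap [k3c2-p2]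
        (∀ x y, ‖((Matrix.of fun k k' : TorusSite 2 L => if k ∈ klBall L μ 0 ∧ k' ∈ klBall L μ 0 then klCovSmearedPairAmplitude L M β U μ (klFlowFrameU L M β U μ (n + 1)) n (softCovOf L M β μ (klFlowFrameU L M β U μ (n + 1)) (softSymbolCompl L M β μ (klFlowFrameU L M β U μ (n + 1)) n (n + 1))) Qm k k' else 0) - klMemberArrayF L M β U μ n (softSymbolCompl L M β μ (klFlowFrameU L M β U μ n) n (n + 1)) Qm) x y‖ ≤ η x y) ∧ (∀ x y, η x y ≤ r') ∧
        -- smallness of the NAMED tower weight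
        (3 / 2 * m + r') * ∑ p, |klSliceWeightSmeared L M β μ (klFlowFrameU L M β U μ (n + 1)) (n + 1) (fun _ => (0 : ℝ)) Qm p| ≤ 1 / 3 ∧
        -- class-#1 four-point kernel sup along the slice (the particle–hole classes' kernels; `V4 ≍ U` at every label)
        0 ≤ M4 ∧ (∀ t ∈ Icc (0 : ℝ) 1, ∀ X, ‖V (n + 1) t X‖ ≤ M4) ∧
        -- the «≥ 2 cross lines» class row (hsucc's `RH₁` at `j = n+1`; its leg-dressing part has `legDressBarQ2·legSliceCountT` IN the slot sum below)
        (∀ t ∈ Icc (0 : ℝ) 1, ∀ x y : TorusSite 2 L, ‖Hd (n + 1) t ![(((omega0 M, y), 0), 0), ((((omega0 M).rev, Qm - y), 1), 0), ((((omega0 M).rev, Qm - x), 1), 1), (((omega0 M, x), 0), 1)]‖ ≤ RH x y) ∧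
        -- the 6–2 / born class AS ONE LOCALISED ROW — the Σ-triple `Σ_(p,σ) (ẇG)(p)·(ΦG)(p)·V6[p,p,y,Qm−y,Qm−x,x]·Σ[p]` with the kernels INSIDE the loop sum (row 63's `RS₁`
        -- member row at `j = n+1`; NO global `‖V6‖ ≤ M6`, `‖Sg‖ ≤ M2` sups — located #22 §4 «(c)-OUT-NEAR-SLICE-LEGS» transfer to the `M6·M2` split)
        (∀ t ∈ Icc (0 : ℝ) 1, ∀ x y : TorusSite 2 L, ‖(∑ p : FreqMomentum L M, ∑ σ : Fin 2, (((((Wd t p) : ℝ) : ℂ) * (((β * (L : ℝ) ^ 2 : ℝ) : ℂ) * propCT L M β μ (klFlowFrameU L M β U μ (n + 1)) p)) * ((((Φ (n + 1) t p) : ℝ) : ℂ) * (((β * (L : ℝ) ^ 2 : ℝ) : ℂ) * propCT L M β μ (klFlowFrameU L M β U μ (n + 1)) p))) * (V6 (n + 1) t ![((p, σ), 0), ((p, σ), 1), (((omega0 M, y), 0), 0), ((((omega0 M).rev, Qm - y), 1), 0), ((((omega0 M).rev, Qm - x), 1), 1), (((omega0 M, x), 0), 1)] * Sg (n + 1) t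 p σ))‖ ≤ RS x y) ∧
        -- the localisation row (hsucc's `RL₁` at `j = n+1`)
        (∀ t ∈ Icc (0 : ℝ) 1, ∀ x y : TorusSite 2 L, ‖∑ z : TorusSite 2 L × MatsubaraIdx M, Br (n + 1) Qm t z * ((if z.1 ∈ klBall L μ 0 then V (n + 1) t ![(((omega0 M, z.1), 0), 0), ((((omega0 M).rev, Qm - z.1), 1), 0), ((((omega0 M).rev, Qm - x), 1), 1), (((omega0 M, x), 0), 1)] * V (n + 1) t ![(((omega0 M, y), 0), 0), ((((omega0 M).rev, Qm - y), 1), 0), ((((omega0 M).rev, Qm - z.1), 1), 1), (((omega0 M, z.1), 0), 1)] else 0) - V (n + 1) t ![(((z.2, z.1), 0), 0), (((z.2.rev, Qm - z.1), 1), 0), ((((omega0 M).rev, Qm - x), 1), 1), (((omega0 M, x), 0), 1)] * V (n + 1) t ![(((omega0 M, y), 0), 0), ((((omega0 M).rev, Qm - y), 1), 0), (((z.2.rev, Qm - z.1), 1), 1), (((z.2, z.1), 0), 1)])‖ ≤ RL x y) ∧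
        -- consumer-side rows at the bar `Tb Qm` and the slot `Bar Qm`; the source majorant `FT_ρ[J] + FT_w[η]` is WRITTEN OUT, the member's two particle–hole weight masses
        -- replaced by their MODEL envelopes («PH-PROFILE» flat core / two-shell tail, flat at `n = 0`), the born class carried by the localised row `RS`
        (∀ x y, Tb Qm x y ≤ r') ∧
        (∀ x y, ((((klScale klE0 n - klScale klE0 (n + 1)) * (2⁻¹ * RH x y + ((β * (L : ℝ) ^ 2) ^ 3)⁻¹ * (M4 * M4 * ((if n = 0 then (2048 * 15367 : ℝ) else if (4 + 8 / 3 * Rn.Gfr 1 * U ^ 2) * klTorusNorm L (x - y) < klScale klE0 (n + 1) / 8 then 2048 * 15367 else 512 / 3 * (27 / (8 * Real.pi ^ 2)) * A2s * (16 / Real.pi) * (10 + 50 * (4 + 8 / 3 * Rn.Gfr 1 * U ^ 2) * β / L) * (16384 * (4 + 8 / 3 * Rn.Gfr 1 * U ^ 2) ^ 2 * min (klTorusNorm L (x - y) / klScale klE0 (n + 1)) (klScale klE0 (n + 1) / klTorusNorm L (x - y)) + Real.sqrt 2 / 4 * ((2 : ℝ) ^ n)⁻¹)) / ((klScale klE0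 n - klScale klE0 (n + 1)) * ((β * (L : ℝ) ^ 2) ^ 3)⁻¹)) + M4 * M4 * ((if n = 0 then (1024 * 15367 : ℝ) else if (4 + 8 / 3 * Rn.Gfr 1 * U ^ 2) * klTorusNorm L (x + y - Qm) < klScale klE0 (n + 1) / 8 then 1024 * 15367 else 256 / 3 * (27 / (8 * Real.pi ^ 2)) * A2s * (16 / Real.pi) * (10 + 50 * (4 + 8 / 3 * Rn.Gfr 1 * U ^ 2) * β / L) * (16384 * (4 + 8 / 3 * Rn.Gfr 1 * U ^ 2) ^ 2 * min (klTorusNorm L (x + y - Qm) / klScale klE0 (n + 1)) (klScale klE0 (n + 1) / klTorusNorm L (x + y - Qm)) + Real.sqrt 2 / 4 * ((2 : ℝ) ^ n)⁻¹)) / ((klScale klE0 n - klScale klE0 (n + 1)) * ((β * (L : ℝ) ^ 2) ^ 3)⁻¹)) + 2 * RS x y)) + RL x y) + 3 / 2 * (3 / 2 * m) * ∑ c, ((klScale klE0 n - klScale klE0 (n + 1)) * (2⁻¹ * RH x c + ((β * (L : ℝ) ^ 2) ^ 3)⁻¹ * (M4 * M4 * ((if n = 0 then (2048 * 15367 : ℝ)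 else if (4 + 8 / 3 * Rn.Gfr 1 * U ^ 2) * klTorusNorm L (x - c) < klScale klE0 (n + 1) / 8 then 2048 * 15367 else 512 / 3 * (27 / (8 * Real.pi ^ 2)) * A2s * (16 / Real.pi) * (10 + 50 * (4 + 8 / 3 * Rn.Gfr 1 * U ^ 2) * β / L) * (16384 * (4 + 8 / 3 * Rn.Gfr 1 * U ^ 2) ^ 2 * min (klTorusNorm L (x - c) / klScale klE0 (n + 1)) (klScale klE0 (n + 1) / klTorusNorm L (x - c)) + Real.sqrt 2 / 4 * ((2 : ℝ) ^ n)⁻¹)) / ((klScale klE0 n - klScale klE0 (n + 1)) * ((β * (L : ℝ) ^ 2) ^ 3)⁻¹)) + M4 * M4 * ((if n = 0 then (1024 * 15367 : ℝ) else if (4 + 8 / 3 * Rn.Gfr 1 * U ^ 2) * klTorusNorm L (x + c - Qm) < klScale klE0 (n + 1) / 8 then 1024 * 15367 else 256 / 3 * (27 / (8 * Real.pi ^ 2)) * A2s * (16 / Real.pi) * (10 + 50 * (4 + 8 / 3 * Rn.Gfr 1 * U ^ 2) * β / L) * (16384 * (4 + 8 / 3 * Rn.Gfr 1 * U ^ 2)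 ^ 2 * min (klTorusNorm L (x + c - Qm) / klScale klE0 (n + 1)) (klScale klE0 (n + 1) / klTorusNorm L (x + c - Qm)) + Real.sqrt 2 / 4 * ((2 : ℝ) ^ n)⁻¹)) / ((klScale klE0 n - klScale klE0 (n + 1)) * ((β * (L : ℝ) ^ 2) ^ 3)⁻¹)) + 2 * RS x c)) + RL x c) * ρ (n + 1) Qm c + 3 / 2 * m * ∑ a, ρ (n + 1) Qm a * ((klScale klE0 n - klScale klE0 (n + 1)) * (2⁻¹ * RH a y + ((β * (L : ℝ) ^ 2) ^ 3)⁻¹ * (M4 * M4 * ((if n = 0 then (2048 * 15367 : ℝ) else if (4 + 8 / 3 * Rn.Gfr 1 * U ^ 2) * klTorusNorm L (a - y) < klScale klE0 (n + 1) / 8 then 2048 * 15367 else 512 / 3 * (27 / (8 * Real.pi ^ 2)) * A2s * (16 / Real.pi) * (10 + 50 * (4 + 8 / 3 * Rn.Gfr 1 * U ^ 2) * β / L) * (16384 * (4 + 8 / 3 * Rn.Gfr 1 * U ^ 2) ^ 2 * min (klTorusNorm L (a - y) / klScale klE0 (n + 1)) (klScale klE0 (n + 1) / klTorusNorm L (a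 - y)) + Real.sqrt 2 / 4 * ((2 : ℝ) ^ n)⁻¹)) / ((klScale klE0 n - klScale klE0 (n + 1)) * ((β * (L : ℝ) ^ 2) ^ 3)⁻¹)) + M4 * M4 * ((if n = 0 then (1024 * 15367 : ℝ) else if (4 + 8 / 3 * Rn.Gfr 1 * U ^ 2) * klTorusNorm L (a + y - Qm) < klScale klE0 (n + 1) / 8 then 1024 * 15367 else 256 / 3 * (27 / (8 * Real.pi ^ 2)) * A2s * (16 / Real.pi) * (10 + 50 * (4 + 8 / 3 * Rn.Gfr 1 * U ^ 2) * β / L) * (16384 * (4 + 8 / 3 * Rn.Gfr 1 * U ^ 2) ^ 2 * min (klTorusNorm L (a + y - Qm) / klScale klE0 (n + 1)) (klScale klE0 (n + 1) / klTorusNorm L (a + y - Qm)) + Real.sqrt 2 / 4 * ((2 : ℝ) ^ n)⁻¹)) / ((klScale klE0 n - klScale klE0 (n + 1)) * ((β * (L : ℝ) ^ 2) ^ 3)⁻¹)) + 2 * RS a y)) + RL a y) + 9 / 4 * m * (3 / 2 * m) * ∑ a, ∑ c, ρ (n + 1) Qm a * ((klScale klE0 n - klScale klE0 (n + 1)) *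 (2⁻¹ * RH a c + ((β * (L : ℝ) ^ 2) ^ 3)⁻¹ * (M4 * M4 * ((if n = 0 then (2048 * 15367 : ℝ) else if (4 + 8 / 3 * Rn.Gfr 1 * U ^ 2) * klTorusNorm L (a - c) < klScale klE0 (n + 1) / 8 then 2048 * 15367 else 512 / 3 * (27 / (8 * Real.pi ^ 2)) * A2s * (16 / Real.pi) * (10 + 50 * (4 + 8 / 3 * Rn.Gfr 1 * U ^ 2) * β / L) * (16384 * (4 + 8 / 3 * Rn.Gfr 1 * U ^ 2) ^ 2 * min (klTorusNorm L (a - c) / klScale klE0 (n + 1)) (klScale klE0 (n + 1) / klTorusNorm L (a - c)) + Real.sqrt 2 / 4 * ((2 : ℝ) ^ n)⁻¹)) / ((klScale klE0 n - klScale klE0 (n + 1)) * ((β * (L : ℝ) ^ 2) ^ 3)⁻¹)) + M4 * M4 * ((if n = 0 then (1024 * 15367 : ℝ) else if (4 + 8 / 3 * Rn.Gfr 1 * U ^ 2) * klTorusNorm L (a + c - Qm) < klScale klE0 (n + 1) / 8 then 1024 * 15367 else 256 / 3 * (27 / (8 * Real.pi ^ 2)) * A2s * (16 / Real.pi) * (10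 + 50 * (4 + 8 / 3 * Rn.Gfr 1 * U ^ 2) * β / L) * (16384 * (4 + 8 / 3 * Rn.Gfr 1 * U ^ 2) ^ 2 * min (klTorusNorm L (a + c - Qm) / klScale klE0 (n + 1)) (klScale klE0 (n + 1) / klTorusNorm L (a + c - Qm)) + Real.sqrt 2 / 4 * ((2 : ℝ) ^ n)⁻¹)) / ((klScale klE0 n - klScale klE0 (n + 1)) * ((β * (L : ℝ) ^ 2) ^ 3)⁻¹)) + 2 * RS a c)) + RL a c) * ρ (n + 1) Qm c) +
            (η x y + 3 / 2 * (3 / 2 * m) * ∑ t, η x t * |klSliceWeightSmeared L M β μ (klFlowFrameU L M β U μ (n + 1)) (n + 1) (fun _ => (0 : ℝ)) Qm t| + 3 / 2 * (3 / 2 * m + r') * ∑ a, |klSliceWeightSmeared L M β μ (klFlowFrameU L M β U μ (n + 1)) (n + 1) (fun _ => (0 : ℝ)) Qm a| * η a y + 9 / 4 * (3 / 2 * m + r') * (3 / 2 * m) * ∑ a, ∑ t, |klSliceWeightSmeared L M β μ (klFlowFrameU L M β U μ (n + 1)) (n + 1) (fun _ => (0 : ℝ)) Qm a| * η a t * |klSliceWeightSmeared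 L M β μ (klFlowFrameU L M β U μ (n + 1)) (n + 1) (fun _ => (0 : ℝ)) Qm t|)) +
          (Tb Qm x y + 3 / 2 * (3 / 2 * m) * ∑ t, Tb Qm x t * |klSliceWeightSmeared L M β μ (klFlowFrameU L M β U μ (n + 1)) (n + 1) (fun _ => (0 : ℝ)) Qm t| + 3 / 2 * (3 / 2 * m + r') * ∑ a, |klSliceWeightSmeared L M β μ (klFlowFrameU L M β U μ (n + 1)) (n + 1) (fun _ => (0 : ℝ)) Qm a| * Tb Qm a y + 9 / 4 * (3 / 2 * m + r') * (3 / 2 * m) * ∑ a, ∑ t, |klSliceWeightSmeared L M β μ (klFlowFrameU L M β U μ (n + 1)) (n + 1) (fun _ => (0 : ℝ)) Qm a| * Tb Qm a t * |klSliceWeightSmeared L M β μ (klFlowFrameU L M β U μ (n + 1)) (n + 1) (fun _ => (0 : ℝ)) Qm t|) ≤ E₁ x y) ∧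
        (∀ x y, E₁ x y ≤ e₁) ∧
        (∀ k ∈ klBall L μ 0, ∀ k' ∈ klBall L μ 0, E₁ k k' ≤ Bar Qm k k')) :
    ∀ Qm : TorusSite 2 L, IsPairClassAt L Qm (n + 1) →
      ∃ (X Nm : Matrix (TorusSite 2 L) (TorusSite 2 L) ℂ) (w₁ : TorusSite 2 L → ℝ) (Ea E₁ : TorusSite 2 L → TorusSite 2 L → ℝ) (r' e₁ : ℝ),
        0 ≤ r' ∧ 0 ≤ e₁ ∧
        (∀ x y, ¬(x ∈ klBall L μ 0 ∧ y ∈ klBall L μ 0) → X x y = 0) ∧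
        (∀ k ∈ klBall L μ 0, ∀ k' ∈ klBall L μ 0,
          X k k' = klCovSmearedPairAmplitude L M β U μ (klFlowFrameU L M β U μ n) n
            (softCovOf L M β μ (klFlowFrameU L M β U μ n) (softSymbolCompl L M β μ (klFlowFrameU L M β U μ n) n (n + 1))) Qm k k') ∧
        (∀ x y, 0 ≤ Ea x y) ∧
        (1 + Matrix.diagonal (fun p => (w₁ p : ℂ)) * X) * Nm = 1 ∧
        (∀ k ∈ klBall L μ 0, ∀ k' ∈ klBall L μ 0, ‖klPairArrayF L M β U μ (n + 1) Qm k k' - (X * Nm) k k'‖ ≤ Ea k k') ∧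
        (∀ x y, Tb Qm x y ≤ r') ∧
        (∀ x y, Ea x y + (Tb Qm x y + 3 / 2 * (3 / 2 * m) * ∑ t, Tb Qm x t * |w₁ t| + 3 / 2 * (3 / 2 * m + r') * ∑ a, |w₁ a| * Tb Qm a y +
            9 / 4 * (3 / 2 * m + r') * (3 / 2 * m) * ∑ a, ∑ t, |w₁ a| * Tb Qm a t * |w₁ t|) ≤ E₁ x y) ∧
        (∀ x y, E₁ x y ≤ e₁) ∧
        (3 / 2 * m + r') * ∑ a, |w₁ a| ≤ 1 / 3 ∧
        (∑ p, |w₁ p| ≤ 3 / 4 * G.bhi) ∧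
        (∑ p, (|w₁ p| - w₁ p) ≤ klEdge G (n + 1) (klTorusNorm L Qm)) ∧
        (∀ k ∈ klBall L μ 0, ∀ k' ∈ klBall L μ 0, E₁ k k' ≤ Bar Qm k k')  := by
  have hβ0 : 0 < β := pos_of_klBetaMin_le hβ
  have hΛ : 0 ≤ klScale klE0 n - klScale klE0 (n + 1) := sub_nonneg.2 (klmf_klScale_succ_pos_le n).2
  have hL0 : (0 : ℝ) < (L : ℝ) := Nat.cast_pos.mpr (Nat.pos_of_ne_zero (NeZero.ne L))
  have hc3 : 0 ≤ ((β * (L : ℝ) ^ 2) ^ 3)⁻¹ := by positivity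
  have hΛd : 0 < (klScale klE0 n - klScale klE0 (n + 1)) * ((β * (L : ℝ) ^ 2) ^ 3)⁻¹ := by
    have hΛp : 0 < klScale klE0 n := klth_klScale_pos n
    have hs : klScale klE0 (n + 1) = klScale klE0 n / 4 := klth_klScale_succ n
    exact mul_pos (by rw [hs]; linarith) (by positivity)
  -- the family member `j = n+1` IS the plain member
  have hs0 : softSymbolCompl L M β μ (klFlowFrameU L M β U μ (n + 1)) (n + 1) (n + 1) = fun _ => (0 : ℝ) := softSymbolCompl_self β μ _ (n + 1)
  -- the doors' rows speak the PINNED symbols `Φ`, `Wd`; the profile lemmas the literal ones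
  subst hΦ hWd
  refine klmt_htower_plain L M hm hK hβ hβL hG hZ (A (n + 1)) (A' (n + 1)) (b (n + 1)) (b' (n + 1))
    (by rw [hAdef]; simp only [hs0]) (by rw [hA'def]; simp only [hs0]) (by rw [hbdef]; simp only [hs0]) (by rw [hb'def]; simp only [hs0]) Tb Bar ?_
  intro Qm hQm
  obtain ⟨r', e₁, M4, η, E₁, RH, RS, RL, hr', he₁, hAm, hXm, hη, hηe, hsm₁, hM40, hM4, hRH, hRS, hRL, hTb, hE₁, hE₁e, hbar⟩ := hrows Qm hQm
  clear hrows
  -- (F)(i): the start of the member curve is the re-framed history member (model object)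
  have hA0 := klmf_memberCurve_zero_eq L M hZ A A' hAdef hA'def (n + 1) Qm
  have hη' : ∀ x y, ‖(A (n + 1) Qm 0 - klMemberArrayF L M β U μ n (softSymbolCompl L M β μ (klFlowFrameU L M β U μ n) n (n + 1)) Qm) x y‖ ≤ η x y := by
    rw [hA0]; exact hη
  have hη0 : ∀ x y, 0 ≤ η x y := fun x y => (norm_nonneg _).trans (hη x y)
  -- the rate profile BY NAME and its total mass
  have hψ0 : ∀ k, 0 ≤ softSymbolCompl L M β μ (klFlowFrameU L M β U μ (n + 1)) (n + 1) (n + 1) k := fun k => by rw [hs0]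
  have hVρ : ∀ c, (∫ τ in (0 : ℝ)..1, ‖b' (n + 1) Qm τ c‖) ≤ ρ (n + 1) Qm c := fun c => by
    rw [hρdef]; beta_reduce
    exact klmf_integral_norm_rate_le_klRungProfile β μ (klFlowFrameU L M β U μ (n + 1)) hβ0 n hψ0 Qm c (fun t p => b' (n + 1) Qm t p) (by rw [hb'def])
  have hsm : 3 / 2 * m * ∑ c, ρ (n + 1) Qm c ≤ 1 / 3 := by
    have h := sum_klRungProfile_compl_le (M := M) β μ (klFlowFrameU L M β U μ (n + 1)) hK hβ hβL (le_refl (n + 1)) Qm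
    rw [hρdef]; beta_reduce
    have h3 : 0 ≤ 3 / 2 * m := by positivity
    exact (mul_le_mul_of_nonneg_left h h3).trans hm7
  -- the member's two particle–hole masses as PROFILES IN THE TRANSFER (flat at `n = 0`)
  have hWdm := fun t (ht : t ∈ Icc (0 : ℝ) 1) (x y : TorusSite 2 L) => (le_div_iff₀' hΛd).2 (klrc_if_bound
    (Wd_member_row_flat_le (M := M) β μ (klFlowFrameU L M β U μ (n + 1)) hK hβ hβL n (le_refl (n + 1)) ht x y) fun hn1 =>
    Wd_member_row_le_profile (M := M) β μ (klFlowFrameU L M β U μ (n + 1)) h2s hA2s hR hU hUu2 hμ hK hβ hβL n (le_refl (n + 1)) hj'β ht hGδ (hE0c hn1) x y)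
  have hWxm := fun t (ht : t ∈ Icc (0 : ℝ) 1) (x y : TorusSite 2 L) => (le_div_iff₀' hΛd).2 (klrc_if_bound
    (Wx_member_row_flat_le (M := M) β μ (klFlowFrameU L M β U μ (n + 1)) hK hβ hβL n (le_refl (n + 1)) ht Qm x y) fun hn1 =>
    Wx_member_row_le_profile (M := M) β μ (klFlowFrameU L M β U μ (n + 1)) h2s hA2s hR hU hUu2 hμ hK hβ hβL n (le_refl (n + 1)) hj'β ht hGδ (hE0c hn1) Qm x y)
  -- the RESOLVED source, pointwise in `t`, through the CLASS-ROWS door: ph classes = kernel sup × weight mass, the Σ-triple as the row `RS`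
  have hM44 : 0 ≤ M4 * M4 := mul_nonneg hM40 hM40
  have hpt : ∀ t ∈ Icc (0 : ℝ) 1, ∀ x y,
      ‖(A' (n + 1) Qm t + A (n + 1) Qm t * diagonal (b' (n + 1) Qm t) * A (n + 1) Qm t) x y‖ ≤ ((klScale klE0 n - klScale klE0 (n + 1)) * (2⁻¹ * RH x y + ((β * (L : ℝ) ^ 2) ^ 3)⁻¹ * (M4 * M4 * ((if n = 0 then (2048 * 15367 : ℝ) else if (4 + 8 / 3 * Rn.Gfr 1 * U ^ 2) * klTorusNorm L (x - y) < klScale klE0 (n + 1) / 8 then 2048 * 15367 else 512 / 3 * (27 / (8 * Real.pi ^ 2)) * A2s * (16 / Real.pi) * (10 + 50 * (4 + 8 / 3 * Rn.Gfr 1 * U ^ 2) * β / L) * (16384 * (4 + 8 / 3 * Rn.Gfr 1 * U ^ 2) ^ 2 * min (klTorusNorm L (x - y) / klScale klE0 (n + 1)) (klScale klE0 (n + 1) / klTorusNorm L (x - y)) + Real.sqrt 2 / 4 * ((2 : ℝ) ^ n)⁻¹)) / ((klScale klE0 n - klScale klE0 (n + 1)) * ((β * (L : ℝ) ^ 2)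 ^ 3)⁻¹)) + M4 * M4 * ((if n = 0 then (1024 * 15367 : ℝ) else if (4 + 8 / 3 * Rn.Gfr 1 * U ^ 2) * klTorusNorm L (x + y - Qm) < klScale klE0 (n + 1) / 8 then 1024 * 15367 else 256 / 3 * (27 / (8 * Real.pi ^ 2)) * A2s * (16 / Real.pi) * (10 + 50 * (4 + 8 / 3 * Rn.Gfr 1 * U ^ 2) * β / L) * (16384 * (4 + 8 / 3 * Rn.Gfr 1 * U ^ 2) ^ 2 * min (klTorusNorm L (x + y - Qm) / klScale klE0 (n + 1)) (klScale klE0 (n + 1) / klTorusNorm L (x + y - Qm)) + Real.sqrt 2 / 4 * ((2 : ℝ) ^ n)⁻¹)) / ((klScale klE0 n - klScale klE0 (n + 1)) * ((β * (L : ℝ) ^ 2) ^ 3)⁻¹)) + 2 * RS x y)) + RL x y) := fun t ht x y => by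
    have hK4 : ∀ X X', ‖V (n + 1) t X * V (n + 1) t X'‖ ≤ M4 * M4 := fun X X' => by
      rw [norm_mul]; exact mul_le_mul (hM4 t ht X) (hM4 t ht X') (norm_nonneg _) hM40
    exact (klmd_defect_le_rows_family L M β U μ (klFlowFrameU L M β U μ (n + 1)) hβ0 n A A' b' hAdef hA'def hb'def V hV V6 hV6 Sg hSg Hd hHd _ rfl _ rfl
      Br hBr (n + 1) Qm ht x y (hRH t ht x y) (klmd_sum3_ite_mul_le _ _ _ fun _ _ _ _ => hK4 _ _) (klmd_sum2_ite_mul_le _ _ _ fun _ _ _ => hK4 _ _)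
      (hRS t ht x y) (hRL t ht x y)).trans (klmt_sigma_mono hΛ hc3 hM44 (hWdm t ht x y) (hWxm t ht x y))
  have hI : ∀ x y, (∫ t in (0 : ℝ)..1, ‖(A' (n + 1) Qm t + A (n + 1) Qm t * diagonal (b' (n + 1) Qm t) * A (n + 1) Qm t) x y‖) ≤ ((klScale klE0 n - klScale klE0 (n + 1)) * (2⁻¹ * RH x y + ((β * (L : ℝ) ^ 2) ^ 3)⁻¹ * (M4 * M4 * ((if n = 0 then (2048 * 15367 : ℝ) else if (4 + 8 / 3 * Rn.Gfr 1 * U ^ 2) * klTorusNorm L (x - y) < klScale klE0 (n + 1) / 8 then 2048 * 15367 else 512 / 3 * (27 / (8 * Real.pi ^ 2)) * A2s * (16 / Real.pi) * (10 + 50 * (4 + 8 / 3 * Rn.Gfr 1 * U ^ 2) * β / L) * (16384 * (4 + 8 / 3 * Rn.Gfr 1 * U ^ 2) ^ 2 * min (klTorusNorm L (x - y) / klScale klE0 (n + 1)) (klScale klE0 (n + 1) / klTorusNorm L (x - y)) + Real.sqrt 2 / 4 * ((2 : ℝ) ^ n)⁻¹)) / ((klScale klE0 n - klScale klE0 (n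 + 1)) * ((β * (L : ℝ) ^ 2) ^ 3)⁻¹)) + M4 * M4 * ((if n = 0 then (1024 * 15367 : ℝ) else if (4 + 8 / 3 * Rn.Gfr 1 * U ^ 2) * klTorusNorm L (x + y - Qm) < klScale klE0 (n + 1) / 8 then 1024 * 15367 else 256 / 3 * (27 / (8 * Real.pi ^ 2)) * A2s * (16 / Real.pi) * (10 + 50 * (4 + 8 / 3 * Rn.Gfr 1 * U ^ 2) * β / L) * (16384 * (4 + 8 / 3 * Rn.Gfr 1 * U ^ 2) ^ 2 * min (klTorusNorm L (x + y - Qm) / klScale klE0 (n + 1)) (klScale klE0 (n + 1) / klTorusNorm L (x + y - Qm)) + Real.sqrt 2 / 4 * ((2 : ℝ) ^ n)⁻¹)) / ((klScale klE0 n - klScale klE0 (n + 1)) * ((β * (L : ℝ) ^ 2) ^ 3)⁻¹)) + 2 * RS x y)) + RL x y) :=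
    fun x y => klmt_integral_norm_le_of_forall fun t ht => hpt t ht x y
  exact ⟨r', e₁, ρ (n + 1) Qm, η, fun x y => ((klScale klE0 n - klScale klE0 (n + 1)) * (2⁻¹ * RH x y + ((β * (L : ℝ) ^ 2) ^ 3)⁻¹ * (M4 * M4 * ((if n = 0 then (2048 * 15367 : ℝ) else if (4 + 8 / 3 * Rn.Gfr 1 * U ^ 2) * klTorusNorm L (x - y) < klScale klE0 (n + 1) / 8 then 2048 * 15367 else 512 / 3 * (27 / (8 * Real.pi ^ 2)) * A2s * (16 / Real.pi) * (10 + 50 * (4 + 8 / 3 * Rn.Gfr 1 * U ^ 2) * β / L) * (16384 * (4 + 8 / 3 * Rn.Gfr 1 * U ^ 2) ^ 2 * min (klTorusNorm L (x - y) / klScale klE0 (n + 1)) (klScale klE0 (n + 1) / klTorusNorm L (x - y)) + Real.sqrt 2 / 4 * ((2 : ℝ) ^ n)⁻¹)) / ((klScale klE0 n - klScale klE0 (n + 1)) * ((β * (L : ℝ) ^ 2) ^ 3)⁻¹)) + M4 * M4 * ((if n = 0 then (1024 * 15367 : ℝ) else if (4 + 8 / 3 * Rn.Gfr 1 * U ^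 2) * klTorusNorm L (x + y - Qm) < klScale klE0 (n + 1) / 8 then 1024 * 15367 else 256 / 3 * (27 / (8 * Real.pi ^ 2)) * A2s * (16 / Real.pi) * (10 + 50 * (4 + 8 / 3 * Rn.Gfr 1 * U ^ 2) * β / L) * (16384 * (4 + 8 / 3 * Rn.Gfr 1 * U ^ 2) ^ 2 * min (klTorusNorm L (x + y - Qm) / klScale klE0 (n + 1)) (klScale klE0 (n + 1) / klTorusNorm L (x + y - Qm)) + Real.sqrt 2 / 4 * ((2 : ℝ) ^ n)⁻¹)) / ((klScale klE0 n - klScale klE0 (n + 1)) * ((β * (L : ℝ) ^ 2) ^ 3)⁻¹)) + 2 * RS x y)) + RL x y),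
    fun x y => (((klScale klE0 n - klScale klE0 (n + 1)) * (2⁻¹ * RH x y + ((β * (L : ℝ) ^ 2) ^ 3)⁻¹ * (M4 * M4 * ((if n = 0 then (2048 * 15367 : ℝ) else if (4 + 8 / 3 * Rn.Gfr 1 * U ^ 2) * klTorusNorm L (x - y) < klScale klE0 (n + 1) / 8 then 2048 * 15367 else 512 / 3 * (27 / (8 * Real.pi ^ 2)) * A2s * (16 / Real.pi) * (10 + 50 * (4 + 8 / 3 * Rn.Gfr 1 * U ^ 2) * β / L) * (16384 * (4 + 8 / 3 * Rn.Gfr 1 * U ^ 2) ^ 2 * min (klTorusNorm L (x - y) / klScale klE0 (n + 1)) (klScale klE0 (n + 1) / klTorusNorm L (x - y)) + Real.sqrt 2 / 4 * ((2 : ℝ) ^ n)⁻¹)) / ((klScale klE0 n - klScale klE0 (n + 1)) * ((β * (L : ℝ) ^ 2) ^ 3)⁻¹)) + M4 * M4 * ((if n = 0 then (1024 * 15367 : ℝ) else if (4 + 8 / 3 * Rn.Gfr 1 * U ^ 2) * klTorusNorm L (x + y - Qm) < klScale klE0 (n + 1) / 8 then 1024 * 15367 else 256 / 3 * (27 / (8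 * Real.pi ^ 2)) * A2s * (16 / Real.pi) * (10 + 50 * (4 + 8 / 3 * Rn.Gfr 1 * U ^ 2) * β / L) * (16384 * (4 + 8 / 3 * Rn.Gfr 1 * U ^ 2) ^ 2 * min (klTorusNorm L (x + y - Qm) / klScale klE0 (n + 1)) (klScale klE0 (n + 1) / klTorusNorm L (x + y - Qm)) + Real.sqrt 2 / 4 * ((2 : ℝ) ^ n)⁻¹)) / ((klScale klE0 n - klScale klE0 (n + 1)) * ((β * (L : ℝ) ^ 2) ^ 3)⁻¹)) + 2 * RS x y)) + RL x y) + 3 / 2 * (3 / 2 * m) * ∑ c, ((klScale klE0 n - klScale klE0 (n + 1)) * (2⁻¹ * RH x c + ((β * (L : ℝ) ^ 2) ^ 3)⁻¹ * (M4 * M4 * ((if n = 0 then (2048 * 15367 : ℝ) else if (4 + 8 / 3 * Rn.Gfr 1 * U ^ 2) * klTorusNorm L (x - c) < klScale klE0 (n + 1) / 8 then 2048 * 15367 else 512 / 3 * (27 / (8 * Real.pi ^ 2)) * A2s * (16 / Real.pi) * (10 + 50 * (4 + 8 / 3 * Rn.Gfr 1 * U ^ 2) * β / L) * (16384 * (4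 + 8 / 3 * Rn.Gfr 1 * U ^ 2) ^ 2 * min (klTorusNorm L (x - c) / klScale klE0 (n + 1)) (klScale klE0 (n + 1) / klTorusNorm L (x - c)) + Real.sqrt 2 / 4 * ((2 : ℝ) ^ n)⁻¹)) / ((klScale klE0 n - klScale klE0 (n + 1)) * ((β * (L : ℝ) ^ 2) ^ 3)⁻¹)) + M4 * M4 * ((if n = 0 then (1024 * 15367 : ℝ) else if (4 + 8 / 3 * Rn.Gfr 1 * U ^ 2) * klTorusNorm L (x + c - Qm) < klScale klE0 (n + 1) / 8 then 1024 * 15367 else 256 / 3 * (27 / (8 * Real.pi ^ 2)) * A2s * (16 / Real.pi) * (10 + 50 * (4 + 8 / 3 * Rn.Gfr 1 * U ^ 2) * β / L) * (16384 * (4 + 8 / 3 * Rn.Gfr 1 * U ^ 2) ^ 2 * min (klTorusNorm L (x + c - Qm) / klScale klE0 (n + 1)) (klScale klE0 (n + 1) / klTorusNorm L (x + c - Qm)) + Real.sqrt 2 / 4 * ((2 : ℝ) ^ n)⁻¹)) / ((klScale klE0 n - klScale klE0 (n + 1)) * ((β * (L : ℝ) ^ 2) ^ 3)⁻¹)) +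 2 * RS x c)) + RL x c) * ρ (n + 1) Qm c + 3 / 2 * m * ∑ a, ρ (n + 1) Qm a * ((klScale klE0 n - klScale klE0 (n + 1)) * (2⁻¹ * RH a y + ((β * (L : ℝ) ^ 2) ^ 3)⁻¹ * (M4 * M4 * ((if n = 0 then (2048 * 15367 : ℝ) else if (4 + 8 / 3 * Rn.Gfr 1 * U ^ 2) * klTorusNorm L (a - y) < klScale klE0 (n + 1) / 8 then 2048 * 15367 else 512 / 3 * (27 / (8 * Real.pi ^ 2)) * A2s * (16 / Real.pi) * (10 + 50 * (4 + 8 / 3 * Rn.Gfr 1 * U ^ 2) * β / L) * (16384 * (4 + 8 / 3 * Rn.Gfr 1 * U ^ 2) ^ 2 * min (klTorusNorm L (a - y) / klScale klE0 (n + 1)) (klScale klE0 (n + 1) / klTorusNorm L (a - y)) + Real.sqrt 2 / 4 * ((2 : ℝ) ^ n)⁻¹)) / ((klScale klE0 n - klScale klE0 (n + 1)) * ((β * (L : ℝ) ^ 2) ^ 3)⁻¹)) + M4 * M4 * ((if n = 0 then (1024 * 15367 : ℝ) else if (4 + 8 / 3 * Rn.Gfr 1 * U ^ 2) * klTorusNorm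 L (a + y - Qm) < klScale klE0 (n + 1) / 8 then 1024 * 15367 else 256 / 3 * (27 / (8 * Real.pi ^ 2)) * A2s * (16 / Real.pi) * (10 + 50 * (4 + 8 / 3 * Rn.Gfr 1 * U ^ 2) * β / L) * (16384 * (4 + 8 / 3 * Rn.Gfr 1 * U ^ 2) ^ 2 * min (klTorusNorm L (a + y - Qm) / klScale klE0 (n + 1)) (klScale klE0 (n + 1) / klTorusNorm L (a + y - Qm)) + Real.sqrt 2 / 4 * ((2 : ℝ) ^ n)⁻¹)) / ((klScale klE0 n - klScale klE0 (n + 1)) * ((β * (L : ℝ) ^ 2) ^ 3)⁻¹)) + 2 * RS a y)) + RL a y) + 9 / 4 * m * (3 / 2 * m) * ∑ a, ∑ c, ρ (n + 1) Qm a * ((klScale klE0 n - klScale klE0 (n + 1)) * (2⁻¹ * RH a c + ((β * (L : ℝ) ^ 2) ^ 3)⁻¹ * (M4 * M4 * ((if n = 0 then (2048 * 15367 : ℝ) else if (4 + 8 / 3 * Rn.Gfr 1 * U ^ 2) * klTorusNorm L (a - c) < klScale klE0 (n + 1) / 8 then 2048 * 15367 else 512 / 3 * (27 / (8 * Real.pi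 ^ 2)) * A2s * (16 / Real.pi) * (10 + 50 * (4 + 8 / 3 * Rn.Gfr 1 * U ^ 2) * β / L) * (16384 * (4 + 8 / 3 * Rn.Gfr 1 * U ^ 2) ^ 2 * min (klTorusNorm L (a - c) / klScale klE0 (n + 1)) (klScale klE0 (n + 1) / klTorusNorm L (a - c)) + Real.sqrt 2 / 4 * ((2 : ℝ) ^ n)⁻¹)) / ((klScale klE0 n - klScale klE0 (n + 1)) * ((β * (L : ℝ) ^ 2) ^ 3)⁻¹)) + M4 * M4 * ((if n = 0 then (1024 * 15367 : ℝ) else if (4 + 8 / 3 * Rn.Gfr 1 * U ^ 2) * klTorusNorm L (a + c - Qm) < klScale klE0 (n + 1) / 8 then 1024 * 15367 else 256 / 3 * (27 / (8 * Real.pi ^ 2)) * A2s * (16 / Real.pi) * (10 + 50 * (4 + 8 / 3 * Rn.Gfr 1 * U ^ 2) * β / L) * (16384 * (4 + 8 / 3 * Rn.Gfr 1 * U ^ 2) ^ 2 * min (klTorusNorm L (a + c - Qm) / klScale klE0 (n + 1)) (klScale klE0 (n + 1) / klTorusNorm L (a + c - Qm)) + Real.sqrt 2 / 4 * ((2 :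 ℝ) ^ n)⁻¹)) / ((klScale klE0 n - klScale klE0 (n + 1)) * ((β * (L : ℝ) ^ 2) ^ 3)⁻¹)) + 2 * RS a c)) + RL a c) * ρ (n + 1) Qm c) +
            (η x y + 3 / 2 * (3 / 2 * m) * ∑ t, η x t * |klSliceWeightSmeared L M β μ (klFlowFrameU L M β U μ (n + 1)) (n + 1) (fun _ => (0 : ℝ)) Qm t| + 3 / 2 * (3 / 2 * m + r') * ∑ a, |klSliceWeightSmeared L M β μ (klFlowFrameU L M β U μ (n + 1)) (n + 1) (fun _ => (0 : ℝ)) Qm a| * η a y + 9 / 4 * (3 / 2 * m + r') * (3 / 2 * m) * ∑ a, ∑ t, |klSliceWeightSmeared L M β μ (klFlowFrameU L M β U μ (n + 1)) (n + 1) (fun _ => (0 : ℝ)) Qm a| * η a t * |klSliceWeightSmeared L M β μ (klFlowFrameU L M β U μ (n + 1)) (n + 1) (fun _ => (0 : ℝ)) Qm t|),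
    E₁, hr', he₁, hAm, hVρ, hsm, hXm, hη0, hη', hηe, hsm₁, hI, fun x y => le_rfl, hTb, hE₁, hE₁e, hbar⟩

end Summit.HubbardSuperconductivity.HubbardSuperconductivity.Theorems.KLRegimeSplit

end
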